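import Mathlib

/-!
# Two generators for the displacement ideal (solo-blind RoS, paper §18.8)

Algebraic skeleton of the *ideal form* of Conjecture F.  For an automorphism `σ` of a regular local
ring `(R, 𝔪)` of dimension three the displacement ideal `I_σ = (σx - x, σy - y, σz - z)` cuts out the
fixed-point scheme.  Conjecture F (ideal form) says that at a `(ii₁)` boundary zero `I_σ` is generated by
TWO of the three displacements, so that the residual zero locus is a curve through the point.  The
mechanism by which an (approximately) invariant coordinate forces this is Nakayama's lemma: if
`σy - y ∈ (σx - x, σz - z) + 𝔪 • I_σ` then `I_σ = (σx - x, σz - z)`.  We record the general statement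
(`ideal_eq_of_le_sup_maximalIdeal_smul`), the three-generator corollary (`span_triple_eq_span_pair`)
and the exact second-order Taylor identity for displacements of products
(`displacement_mul`), which is what makes an invariant function act on `I_σ / 𝔪 I_σ` through its
differential only.
-/

namespace Summit.ResolutionOfSingularities.ResolutionOfSingularities.Theorems.SoloBlind

open IsLocalRing

section Nakayama

variable {R : Type*} [CommRing R] [IsLocalRing R]

/-- Nakayama in a local ring: if `J ≤ I`, `I` is finitely generated and `I ≤ J ⊔ 𝔪 • I`, then `I = J`. -/
theorem ideal_eq_of_le_sup_maximalIdeal_smul {I J : Ideal R} (hJI : J ≤ I) (hI : I.FG)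
    (h : I ≤ J ⊔ maximalIdeal R • I) : I = J :=
  le_antisymm (Submodule.le_of_le_smul_of_le_jacobson_bot hI (maximalIdeal_le_jacobson ⊥) h) hJI

/-- Three generators, one redundant modulo `𝔪 • I`: if `b ∈ (a, c) + 𝔪 • (a, b, c)` then
`(a, b, c) = (a, c)`.  Applied to `(a, b, c) = (σx - x, σy - y, σz - z)` this is the statement
"an approximately invariant coordinate makes the fixed-point scheme a two-equation locus". -/
theorem span_triple_eq_span_pair {a b c : R}
    (h : b ∈ Ideal.span {a, c} ⊔ maximalIdeal R • Ideal.span {a, b, c}) :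
    Ideal.span ({a, b, c} : Set R) = Ideal.span {a, c} := by
  apply ideal_eq_of_le_sup_maximalIdeal_smul
  · exact Ideal.span_mono (by
      intro x hx
      simp only [Set.mem_insert_iff, Set.mem_singleton_iff] at hx ⊢
      tauto)
  · exact Submodule.fg_span (Set.toFinite _)
  · rw [Ideal.span_le]
    intro x hx
    simp only [Set.mem_insert_iff, Set.mem_singleton_iff] at hx
    rcases hx with rfl | rfl | rfl
    · exact Submodule.mem_sup_left (Ideal.subset_span (by simp))
    · exact h
    · exact Submodule.mem_sup_left (Ideal.subset_span (by simp))

end Nakayama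

section Displacement

variable {R : Type*} [CommRing R] (σ : R →+* R)

/-- Exact Taylor identity for the displacement `δ = σ - id` on a product:
`δ(uv) = δu · v + u · δv + δu · δv`.  Hence `δ(uv) ≡ δu · v + u · δv` modulo `I_σ²`, i.e. the class of
`δw` in `I_σ / 𝔪 I_σ` depends only on the differential of `w` at the closed point. -/
theorem displacement_mul (u v : R) :
    σ (u * v) - u * v = (σ u - u) * v + u * (σ v - v) + (σ u - u) * (σ v - v) := by
  rw [map_mul]; ring

/-- The correction term lies in the square of the displacement ideal. -/
theorem displacement_mul_mem_sq (u v : R) (I : Ideal R) (hu : σ u - u ∈ I) (hv : σ v - v ∈ I) :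
    σ (u * v) - u * v - ((σ u - u) * v + u * (σ v - v)) ∈ I ^ 2 := by
  have : σ (u * v) - u * v - ((σ u - u) * v + u * (σ v - v)) = (σ u - u) * (σ v - v) := by
    rw [map_mul]; ring
  rw [this, pow_two]
  exact Ideal.mul_mem_mul hu hv

/-- An invariant element contributes nothing: if `σ w = w` then for every `v`,
`σ (w * v) - w * v = w * (σ v - v)`. -/
theorem displacement_mul_of_invariant {w : R} (hw : σ w = w) (v : R) :
    σ (w * v) - w * v = w * (σ v - v) := by
  rw [map_mul, hw]; ring

end Displacement

end Summit.ResolutionOfSingularities.ResolutionOfSingularities.Theorems.SoloBlind
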